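import Summits.CriticalPhenomena.CardyFormulaZ2.Theses.CardyBoundaryCoulombGas
import Summits.CriticalPhenomena.CardyFormulaZ2.Theorems.StripClusterRates.Negative.KacFromAboveFalse
import Summits.CriticalPhenomena.CardyFormulaZ2.Theorems.CardyBoundaryCoulombGasStripClusterRatesStubOneClusterDictionary
import Summits.CriticalPhenomena.CardyFormulaZ2.Theorems.CardyBoundaryCoulombGasStripClusterRatesStubPlanarReachable
import Summits.CriticalPhenomena.CardyFormulaZ2.Theorems.CardyBoundaryCoulombGasStripClusterRatesStubOneClusterSpectral
import Summits.CriticalPhenomena.CardyFormulaZ2.Theorems.CardyBoundaryCoulombGasStripClusterRatesStubTwoClusterDictionary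
import Summits.CriticalPhenomena.CardyFormulaZ2.Theorems.CardyBoundaryCoulombGasStripClusterRatesStubRelaxationUpper
import Summits.CriticalPhenomena.CardyFormulaZ2.Theorems.CardyBoundaryCoulombGasStripClusterRatesStubRelaxationLower
import Literature.Probability.LatticeModels.RowStatePlanar
import Literature.Probability.Percolation.LatticeSymmetry

/-!
# `StripClusterRates` ⟺ Kac gap asymptotics of the planar `⋆`-chain (line `two-cluster-rate-is-stationary-gap`)

Crux `Summit.CriticalPhenomena.CardyFormulaZ2.Theses.CardyBoundaryCoulombGas.StripClusterRates` (stmt-CriticalPhenomena-13878), line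
`two-cluster-rate-is-stationary-gap` (lead prover-line-stmt-CriticalPhenomena-13878-0), REDUCTION FILE.

With the six landed stubs of the line (`stub_oneClusterDictionary`, `stub_planarReachable`,
`stub_oneClusterSpectral`, `stub_twoClusterDictionary`, `stub_relaxationUpper`, `stub_relaxationLower`) the two
halves of the route's foreseen `RateIsGap` are THEOREMS, assembled here:

* `oneClusterRate_eq_escapeRate` — for every width `n ≥ 1` the lengthwise one-cluster rate
  `γ₁(n) = lim_m -log P_{1/2}[LR(m,n)]/m` EXISTS and `e^{-γ₁(n)}` is the escape modulus (Perron root of the marked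
  block) of the stochastic planar `⋆`-chain `planarTransfer (Finset.Icc 0 n)`;
* `twoClusterRate_eq_relaxationRate` — for every `n ≥ 1` the two-cluster rate `γ₂(n)` EXISTS and `e^{-γ₂(n)}` is
  the relaxation modulus (SLEM of the unmarked block) of the same chain (coupling sandwich + the landed Negative
  lemma `pTwo_ge` for positivity);

and the crux is thereby EQUIVALENT to the pure spectral-asymptotics statement "Kac gap asymptotics"
(`n·(-log ρ_marked(n)) → π/3`, `n·(-log SLEM_unmarked(n)) → 2π`), the remaining registered stub
`stub_kacGapAsymptotics` of the skeleton: `stripClusterRates_iff_kacGapAsymptotics` (both directions proved here;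
the converse uses uniqueness of limits and of the two moduli). Everything is stated over tree vocabulary, inlined
(no definitions). Sources: BondesanJacobsenSaleur2012 §2/§5.1 (connectivity transfer matrix), Cardy1998 eq. (bb)
(the predicted constants), LevinPeresWilmer2009 Ch. 12 (relaxation rate), DingZhou2009 Thm 2.6 (Perron–Frobenius).
-/

noncomputable section

namespace Summit.CriticalPhenomena.CardyFormulaZ2.Cruxes.StripClusterRates.TwoClusterRateIsStationaryGap

open Filter Topology
open scoped BigOperators Classical
open Literature.Probability.Percolation Literature.Probability.LatticeModels

/-- **Rates from two-sided geometric bounds.** If `0 < a m`, `c s^m ≤ a m` for some `c > 0`, and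
`a m ≤ C_{s'} s'^m` for every `s' > s > 0`, then `-log (a m)/m → -log s`. [folklore] -/
theorem red_tendsto_rate_of_geometric_bounds {a : ℕ → ℝ} {s : ℝ} (hs : 0 < s) (ha : ∀ m, 0 < a m)
    (hlow : ∃ c : ℝ, 0 < c ∧ ∀ m, c * s ^ m ≤ a m)
    (hup : ∀ s' : ℝ, s < s' → ∃ C : ℝ, ∀ m, a m ≤ C * s' ^ m) :
    Tendsto (fun m : ℕ => -Real.log (a m) / (m : ℝ)) atTop (𝓝 (-Real.log s)) := by
  rw [tendsto_order]
  constructor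
  · intro b hb
    set b' : ℝ := (b + -Real.log s) / 2 with hb'
    have hbb' : b < b' := by rw [hb']; linarith
    obtain ⟨C, hC⟩ := hup (Real.exp (-b')) (by
      calc s = Real.exp (Real.log s) := (Real.exp_log hs).symm
        _ < Real.exp (-b') := Real.exp_lt_exp.2 (by rw [hb']; linarith))
    have hC0 : 0 < C := by
      have h0 := hC 0
      simp only [pow_zero, mul_one] at h0
      exact (ha 0).trans_le h0
    have hlim : Tendsto (fun m : ℕ => b' - Real.log C / (m : ℝ)) atTop (𝓝 (b' - 0)) :=
      tendsto_const_nhds.sub (tendsto_const_div_atTop_nhds_zero_nat (Real.log C))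
    rw [sub_zero] at hlim
    have hev := (tendsto_order.1 hlim).1 b hbb'
    filter_upwards [hev, eventually_ge_atTop 1] with m hm hm1
    have hm0 : (0 : ℝ) < m := by exact_mod_cast hm1
    have hlog : Real.log (a m) ≤ Real.log C + m * -b' := by
      have h1 := Real.log_le_log (ha m) (hC m)
      rw [Real.log_mul hC0.ne' (pow_ne_zero _ (Real.exp_pos _).ne'), Real.log_pow, Real.log_exp] at h1
      linarith
    calc b < b' - Real.log C / m := hm
      _ ≤ -Real.log (a m) / m := by
          rw [le_div_iff₀ hm0, sub_mul, div_mul_cancel₀ _ hm0.ne']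
          linarith
  · intro b hb
    obtain ⟨c, hc, hca⟩ := hlow
    have hlim : Tendsto (fun m : ℕ => -Real.log s + -Real.log c / (m : ℝ)) atTop (𝓝 (-Real.log s + 0)) :=
      tendsto_const_nhds.add (tendsto_const_div_atTop_nhds_zero_nat (-Real.log c))
    rw [add_zero] at hlim
    have hev := (tendsto_order.1 hlim).2 b hb
    filter_upwards [hev, eventually_ge_atTop 1] with m hm hm1
    have hm0 : (0 : ℝ) < m := by exact_mod_cast hm1
    have hlog : Real.log c + m * Real.log s ≤ Real.log (a m) := by
      have h1 := Real.log_le_log (mul_pos hc (pow_pos hs m)) (hca m)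
      rwa [Real.log_mul hc.ne' (pow_ne_zero _ hs.ne'), Real.log_pow] at h1
    calc -Real.log (a m) / m ≤ -Real.log s + -Real.log c / m := by
          rw [div_le_iff₀ hm0, add_mul, div_mul_cancel₀ _ hm0.ne']
          linarith
      _ < b := hm

/-- **RateIsGap, `k = 1` (one-cluster rate = escape rate).** For every width `n ≥ 1` the lengthwise rate
`γ₁(n) = lim_m -log P_{1/2}[LR crossing of `[0,m]×[0,n]`]/m` exists and `e^{-γ₁(n)}` is the spectral radius of
the marked block of `planarTransfer (Finset.Icc 0 n)` (an eigenpair supported on the marked planar states has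
modulus `e^{-γ₁(n)}`, and all of them have modulus `≤ e^{-γ₁(n)}`). Assembled from the landed stubs D1 (dictionary),
D2 (reachability, marked half) and S1' (Perron–Frobenius step). BondesanJacobsenSaleur2012 §2, DingZhou2009 Thm 2.6.
[cite: BondesanJacobsenSaleur2012, §2] -/
theorem oneClusterRate_eq_escapeRate :
    ∀ n : ℕ, 1 ≤ n → ∃ γ : ℝ,
      Tendsto (fun m : ℕ ↦ -Real.log (crossingProb half m n) / (m : ℝ)) atTop (𝓝 γ) ∧
      ((∃ (μ : ℂ) (v : PlanarRowState (Finset.Icc (0 : ℤ) n) → ℂ),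
          (v ≠ 0 ∧ (∀ p, (∀ x, ¬ p.1.JoinedToStar x) → v p = 0) ∧
            ∀ p, (∃ x, p.1.JoinedToStar x) →
              ∑ q, (planarTransfer (Finset.Icc (0 : ℤ) n) p q : ℂ) * v q = μ * v p) ∧
          ‖μ‖ = Real.exp (-γ)) ∧
        ∀ (μ : ℂ) (v : PlanarRowState (Finset.Icc (0 : ℤ) n) → ℂ),
          (v ≠ 0 ∧ (∀ p, (∀ x, ¬ p.1.JoinedToStar x) → v p = 0) ∧
            ∀ p, (∃ x, p.1.JoinedToStar x) →
              ∑ q, (planarTransfer (Finset.Icc (0 : ℤ) n) p q : ℂ) * v q = μ * v p) →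
          ‖μ‖ ≤ Real.exp (-γ)) :=
  stub_oneClusterSpectral stub_oneClusterDictionary stub_planarReachable.1

/-- `p₂(m,n) > 0` for `n ≥ 1` (the ladder configuration; landed Negative lemma `pTwo_ge`). [folklore] -/
theorem red_pTwo_pos {m n : ℕ} (hn : 1 ≤ n) :
    0 < (bondPercolation (zdGraph 2) half).real
          {ω | ∃ x₁ ∈ (leftSide m n : Set (Site 2)), ∃ y₁ ∈ (rightSide m n : Set (Site 2)),
            ∃ x₂ ∈ (leftSide m n : Set (Site 2)), ∃ y₂ ∈ (rightSide m n : Set (Site 2)),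
              ω ∈ openConnIn (rectangle m n : Set (Site 2)) x₁ y₁ ∧
              ω ∈ openConnIn (rectangle m n : Set (Site 2)) x₂ y₂ ∧
              ω ∉ openConnIn (rectangle m n : Set (Site 2)) x₁ x₂} :=
  lt_of_lt_of_le (by positivity)
    (Summit.CriticalPhenomena.CardyFormulaZ2.Theorems.StripClusterRates.Negative.pTwo_ge (m := m) hn)

/-- **RateIsGap, `k = 2` (two-cluster rate = relaxation rate).** For every width `n ≥ 1` the lengthwise rate
`γ₂(n) = lim_m -log P_{1/2}[two LR crossings of `[0,m]×[0,n]` in distinct clusters]/m` exists and `e^{-γ₂(n)}` is the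
second-largest eigenvalue modulus of the unmarked (stochastic) block of `planarTransfer (Finset.Icc 0 n)`.
Assembled from the landed stubs D3 (coupling dictionary), S2a (SLEM + Gelfand upper bound), S2b (coupling lower
bound) and `pTwo_ge` (which forces the SLEM to be positive). LevinPeresWilmer2009 Ch. 12; BondesanJacobsenSaleur2012 p. 16.
[cite: BondesanJacobsenSaleur2012, §2] -/
theorem twoClusterRate_eq_relaxationRate :
    ∀ n : ℕ, 1 ≤ n → ∃ γ : ℝ,
      Tendsto (fun m : ℕ ↦ -Real.log ((bondPercolation (zdGraph 2) half).real
          {ω | ∃ x₁ ∈ (leftSide m n : Set (Site 2)), ∃ y₁ ∈ (rightSide m n : Set (Site 2)),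
            ∃ x₂ ∈ (leftSide m n : Set (Site 2)), ∃ y₂ ∈ (rightSide m n : Set (Site 2)),
              ω ∈ openConnIn (rectangle m n : Set (Site 2)) x₁ y₁ ∧
              ω ∈ openConnIn (rectangle m n : Set (Site 2)) x₂ y₂ ∧
              ω ∉ openConnIn (rectangle m n : Set (Site 2)) x₁ x₂}) / (m : ℝ)) atTop (𝓝 γ) ∧
      ((∃ (μ : ℂ) (v : PlanarRowState (Finset.Icc (0 : ℤ) n) → ℂ),
          (v ≠ 0 ∧ (∀ p, (∃ x, p.1.JoinedToStar x) → v p = 0) ∧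
            ∀ p, (∀ x, ¬ p.1.JoinedToStar x) →
              ∑ q, (planarTransfer (Finset.Icc (0 : ℤ) n) p q : ℂ) * v q = μ * v p) ∧
          μ ≠ 1 ∧ ‖μ‖ = Real.exp (-γ)) ∧
        ∀ (μ : ℂ) (v : PlanarRowState (Finset.Icc (0 : ℤ) n) → ℂ),
          (v ≠ 0 ∧ (∀ p, (∃ x, p.1.JoinedToStar x) → v p = 0) ∧
            ∀ p, (∀ x, ¬ p.1.JoinedToStar x) →
              ∑ q, (planarTransfer (Finset.Icc (0 : ℤ) n) p q : ℂ) * v q = μ * v p) →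
          μ ≠ 1 → ‖μ‖ ≤ Real.exp (-γ)) := by
  intro n hn
  obtain ⟨s, hmod, hup⟩ := stub_relaxationUpper n hn
  obtain ⟨⟨μ, v, hev, hμ1, hμs⟩, hdom⟩ := hmod
  obtain ⟨c, hc, hlow⟩ := stub_relaxationLower n hn μ v hev hμ1
  obtain ⟨c', hc', hdict⟩ := stub_twoClusterDictionary n hn
  rw [hμs] at hlow
  -- two-sided geometric bounds for `p₂`
  have hlow' : ∀ m : ℕ, c' * c * s ^ m ≤ (bondPercolation (zdGraph 2) half).real
          {ω | ∃ x₁ ∈ (leftSide m n : Set (Site 2)), ∃ y₁ ∈ (rightSide m n : Set (Site 2)),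
            ∃ x₂ ∈ (leftSide m n : Set (Site 2)), ∃ y₂ ∈ (rightSide m n : Set (Site 2)),
              ω ∈ openConnIn (rectangle m n : Set (Site 2)) x₁ y₁ ∧
              ω ∈ openConnIn (rectangle m n : Set (Site 2)) x₂ y₂ ∧
              ω ∉ openConnIn (rectangle m n : Set (Site 2)) x₁ x₂} := by
    intro m
    have h1 := mul_le_mul_of_nonneg_left (hlow m) hc'.le
    have h2 := (hdict m).1
    calc c' * c * s ^ m = c' * (c * s ^ m) := by ring
      _ ≤ _ := h1.trans h2
  have hup' : ∀ s' : ℝ, s < s' → ∃ C : ℝ, ∀ m : ℕ, (bondPercolation (zdGraph 2) half).real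
          {ω | ∃ x₁ ∈ (leftSide m n : Set (Site 2)), ∃ y₁ ∈ (rightSide m n : Set (Site 2)),
            ∃ x₂ ∈ (leftSide m n : Set (Site 2)), ∃ y₂ ∈ (rightSide m n : Set (Site 2)),
              ω ∈ openConnIn (rectangle m n : Set (Site 2)) x₁ y₁ ∧
              ω ∈ openConnIn (rectangle m n : Set (Site 2)) x₂ y₂ ∧
              ω ∉ openConnIn (rectangle m n : Set (Site 2)) x₁ x₂} ≤ C * s' ^ m := by
    intro s' hs'
    obtain ⟨C, hC⟩ := hup s' hs'
    exact ⟨C, fun m => ((hdict m).2).trans (hC m)⟩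
  -- `s > 0`: otherwise `p₂ ≤ C (1/16)^m` contradicts `p₂ ≥ (1/2)(1/8)^m`
  have hs0 : 0 ≤ s := by rw [← hμs]; exact norm_nonneg μ
  have hs : 0 < s := by
    by_contra hneg
    have hs00 : s = 0 := le_antisymm (not_lt.1 hneg) hs0
    obtain ⟨C, hC⟩ := hup' (1 / 16) (by rw [hs00]; norm_num)
    have key : ∀ m : ℕ, (2 : ℝ) ^ m ≤ 2 * C := by
      intro m
      have h1 := (Summit.CriticalPhenomena.CardyFormulaZ2.Theorems.StripClusterRates.Negative.pTwo_ge
        (m := m) hn).trans (hC m)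
      have h2 : (1 / 2 : ℝ) ^ (3 * m + 1) = (2 : ℝ) ^ m * ((1 / 2) * (1 / 16 : ℝ) ^ m) := by
        rw [pow_succ, pow_mul]
        have : ((1 / 2 : ℝ) ^ 3) = (2 : ℝ) * (1 / 16) := by norm_num
        rw [this, mul_pow]
        ring
      rw [h2] at h1
      have hpos : (0 : ℝ) < (1 / 2) * (1 / 16 : ℝ) ^ m := by positivity
      have h3 : (2 : ℝ) ^ m * ((1 / 2) * (1 / 16 : ℝ) ^ m) ≤ (2 * C) * ((1 / 2) * (1 / 16 : ℝ) ^ m) := by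
        calc _ ≤ C * (1 / 16 : ℝ) ^ m := h1
          _ = (2 * C) * ((1 / 2) * (1 / 16 : ℝ) ^ m) := by ring
      exact le_of_mul_le_mul_right h3 hpos
    obtain ⟨m, hm⟩ := pow_unbounded_of_one_lt (2 * C) (by norm_num : (1 : ℝ) < 2)
    exact absurd (key m) (not_le.2 hm)
  refine ⟨-Real.log s, ?_, ?_⟩
  · exact red_tendsto_rate_of_geometric_bounds (a := fun m => (bondPercolation (zdGraph 2) half).real
                {ω | ∃ x₁ ∈ (leftSide m n : Set (Site 2)), ∃ y₁ ∈ (rightSide m n : Set (Site 2)),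
                  ∃ x₂ ∈ (leftSide m n : Set (Site 2)), ∃ y₂ ∈ (rightSide m n : Set (Site 2)),
                    ω ∈ openConnIn (rectangle m n : Set (Site 2)) x₁ y₁ ∧
                    ω ∈ openConnIn (rectangle m n : Set (Site 2)) x₂ y₂ ∧
                    ω ∉ openConnIn (rectangle m n : Set (Site 2)) x₁ x₂}) hs (fun m => red_pTwo_pos hn)
      ⟨c' * c, mul_pos hc' hc, hlow'⟩ hup'
  · rw [neg_neg, Real.exp_log hs]
    exact ⟨⟨μ, v, hev, hμ1, hμs⟩, hdom⟩

/-- `n · -log (e^{-γ}) = n · γ`. [folklore] -/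
theorem red_mul_neg_log_exp_neg (n γ : ℝ) : n * -Real.log (Real.exp (-γ)) = n * γ := by
  rw [Real.log_exp, neg_neg]

/-- **The crux from the Kac gap asymptotics** (`stub_kacGapAsymptotics` of the skeleton, inlined): the rates
`γ₁, γ₂` are chosen from `oneClusterRate_eq_escapeRate` / `twoClusterRate_eq_relaxationRate` at widths `n ≥ 1`
(junk `0` at width `0`), and the asymptotics applied to the sequences `e^{-γ_k(n)}` give `n·γ₁(n) → π/3`,
`n·γ₂(n) → 2π`. This is the line's composition `StripClusterRates_of` with every firm stub discharged; only the
spectral-asymptotics hypothesis (Cardy1998 eq. (bb) in transfer-matrix form; an open problem) remains.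
[cite: Cardy1998, eq. (bb)] -/
theorem stripClusterRates_of_kacGapAsymptotics
    (hK : ((∀ r : ℕ → ℝ,
      (∀ n : ℕ, 1 ≤ n →
        ((∃ (μ : ℂ) (v : PlanarRowState (Finset.Icc (0 : ℤ) n) → ℂ),
          (v ≠ 0 ∧ (∀ p, (∀ x, ¬ p.1.JoinedToStar x) → v p = 0) ∧
            ∀ p, (∃ x, p.1.JoinedToStar x) →
              ∑ q, (planarTransfer (Finset.Icc (0 : ℤ) n) p q : ℂ) * v q = μ * v p) ∧
          ‖μ‖ = r n) ∧
        ∀ (μ : ℂ) (v : PlanarRowState (Finset.Icc (0 : ℤ) n) → ℂ),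
          (v ≠ 0 ∧ (∀ p, (∀ x, ¬ p.1.JoinedToStar x) → v p = 0) ∧
            ∀ p, (∃ x, p.1.JoinedToStar x) →
              ∑ q, (planarTransfer (Finset.Icc (0 : ℤ) n) p q : ℂ) * v q = μ * v p) →
          ‖μ‖ ≤ r n)) →
      Tendsto (fun n : ℕ ↦ (n : ℝ) * -Real.log (r n)) atTop (𝓝 (Real.pi / 3))) ∧
    (∀ s : ℕ → ℝ,
      (∀ n : ℕ, 1 ≤ n →
        ((∃ (μ : ℂ) (v : PlanarRowState (Finset.Icc (0 : ℤ) n) → ℂ),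
          (v ≠ 0 ∧ (∀ p, (∃ x, p.1.JoinedToStar x) → v p = 0) ∧
            ∀ p, (∀ x, ¬ p.1.JoinedToStar x) →
              ∑ q, (planarTransfer (Finset.Icc (0 : ℤ) n) p q : ℂ) * v q = μ * v p) ∧
          μ ≠ 1 ∧ ‖μ‖ = s n) ∧
        ∀ (μ : ℂ) (v : PlanarRowState (Finset.Icc (0 : ℤ) n) → ℂ),
          (v ≠ 0 ∧ (∀ p, (∃ x, p.1.JoinedToStar x) → v p = 0) ∧
            ∀ p, (∀ x, ¬ p.1.JoinedToStar x) →
              ∑ q, (planarTransfer (Finset.Icc (0 : ℤ) n) p q : ℂ) * v q = μ * v p) →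
          μ ≠ 1 → ‖μ‖ ≤ s n)) →
      Tendsto (fun n : ℕ ↦ (n : ℝ) * -Real.log (s n)) atTop (𝓝 (2 * Real.pi))))) :
    Summit.CriticalPhenomena.CardyFormulaZ2.Theses.CardyBoundaryCoulombGas.StripClusterRates := by
  have h₁ := oneClusterRate_eq_escapeRate
  have h₂ := twoClusterRate_eq_relaxationRate
  obtain ⟨h₃, h₄⟩ := hK
  let γ₁ : ℕ → ℝ := fun n => if hn : 1 ≤ n then (h₁ n hn).choose else 0
  let γ₂ : ℕ → ℝ := fun n => if hn : 1 ≤ n then (h₂ n hn).choose else 0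
  have hγ₁ : ∀ n : ℕ, ∀ hn : 1 ≤ n, γ₁ n = (h₁ n hn).choose := fun n hn => dif_pos hn
  have hγ₂ : ∀ n : ℕ, ∀ hn : 1 ≤ n, γ₂ n = (h₂ n hn).choose := fun n hn => dif_pos hn
  refine ⟨γ₁, γ₂, ?_, ?_, ?_, ?_⟩
  · intro n hn
    rw [hγ₁ n hn]
    exact (h₁ n hn).choose_spec.1
  · intro n hn
    rw [hγ₂ n hn]
    exact (h₂ n hn).choose_spec.1
  · have h := h₃ (fun n => Real.exp (-γ₁ n)) (fun n hn => by rw [hγ₁ n hn]; exact (h₁ n hn).choose_spec.2)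
    refine h.congr' (Eventually.of_forall fun n => ?_)
    exact red_mul_neg_log_exp_neg n (γ₁ n)
  · have h := h₄ (fun n => Real.exp (-γ₂ n)) (fun n hn => by rw [hγ₂ n hn]; exact (h₂ n hn).choose_spec.2)
    refine h.congr' (Eventually.of_forall fun n => ?_)
    exact red_mul_neg_log_exp_neg n (γ₂ n)

/-- **The Kac gap asymptotics from the crux**: conversely, `StripClusterRates` implies the spectral
asymptotics, because for `n ≥ 1` the rate limits are unique (`tendsto_nhds_unique`) and the escape / relaxation
moduli are unique (each dominates the other's witnessing eigenpair), so `r(n) = e^{-γ₁(n)}`, `s(n) = e^{-γ₂(n)}`.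
Hence the residual stub of the line is EXACTLY crux-sized. [cite: Cardy1998, eq. (bb)] -/
theorem kacGapAsymptotics_of_stripClusterRates
    (h : Summit.CriticalPhenomena.CardyFormulaZ2.Theses.CardyBoundaryCoulombGas.StripClusterRates) :
    ((∀ r : ℕ → ℝ,
      (∀ n : ℕ, 1 ≤ n →
        ((∃ (μ : ℂ) (v : PlanarRowState (Finset.Icc (0 : ℤ) n) → ℂ),
          (v ≠ 0 ∧ (∀ p, (∀ x, ¬ p.1.JoinedToStar x) → v p = 0) ∧
            ∀ p, (∃ x, p.1.JoinedToStar x) →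
              ∑ q, (planarTransfer (Finset.Icc (0 : ℤ) n) p q : ℂ) * v q = μ * v p) ∧
          ‖μ‖ = r n) ∧
        ∀ (μ : ℂ) (v : PlanarRowState (Finset.Icc (0 : ℤ) n) → ℂ),
          (v ≠ 0 ∧ (∀ p, (∀ x, ¬ p.1.JoinedToStar x) → v p = 0) ∧
            ∀ p, (∃ x, p.1.JoinedToStar x) →
              ∑ q, (planarTransfer (Finset.Icc (0 : ℤ) n) p q : ℂ) * v q = μ * v p) →
          ‖μ‖ ≤ r n)) →
      Tendsto (fun n : ℕ ↦ (n : ℝ) * -Real.log (r n)) atTop (𝓝 (Real.pi / 3))) ∧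
    (∀ s : ℕ → ℝ,
      (∀ n : ℕ, 1 ≤ n →
        ((∃ (μ : ℂ) (v : PlanarRowState (Finset.Icc (0 : ℤ) n) → ℂ),
          (v ≠ 0 ∧ (∀ p, (∃ x, p.1.JoinedToStar x) → v p = 0) ∧
            ∀ p, (∀ x, ¬ p.1.JoinedToStar x) →
              ∑ q, (planarTransfer (Finset.Icc (0 : ℤ) n) p q : ℂ) * v q = μ * v p) ∧
          μ ≠ 1 ∧ ‖μ‖ = s n) ∧
        ∀ (μ : ℂ) (v : PlanarRowState (Finset.Icc (0 : ℤ) n) → ℂ),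
          (v ≠ 0 ∧ (∀ p, (∃ x, p.1.JoinedToStar x) → v p = 0) ∧
            ∀ p, (∀ x, ¬ p.1.JoinedToStar x) →
              ∑ q, (planarTransfer (Finset.Icc (0 : ℤ) n) p q : ℂ) * v q = μ * v p) →
          μ ≠ 1 → ‖μ‖ ≤ s n)) →
      Tendsto (fun n : ℕ ↦ (n : ℝ) * -Real.log (s n)) atTop (𝓝 (2 * Real.pi)))) := by
  obtain ⟨γ₁, γ₂, h1, h2, h3, h4⟩ := h
  refine ⟨fun r hr => ?_, fun s hs => ?_⟩
  · refine h3.congr' ?_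
    filter_upwards [eventually_ge_atTop 1] with n hn
    obtain ⟨γ, hγ, ⟨⟨μ₀, v₀, hμ₀, hn₀⟩, hdom₀⟩⟩ := oneClusterRate_eq_escapeRate n hn
    have hγeq : γ = γ₁ n := tendsto_nhds_unique hγ (h1 n hn)
    obtain ⟨⟨μ₁, v₁, hμ₁, hn₁⟩, hdom₁⟩ := hr n hn
    have hle1 : r n ≤ Real.exp (-γ) := hn₁.symm.le.trans (hdom₀ μ₁ v₁ hμ₁)
    have hle2 : Real.exp (-γ) ≤ r n := hn₀.symm.le.trans (hdom₁ μ₀ v₀ hμ₀)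
    have hrn : r n = Real.exp (-γ) := le_antisymm hle1 hle2
    show (n : ℝ) * γ₁ n = n * -Real.log (r n)
    rw [hrn, Real.log_exp, neg_neg, hγeq]
  · refine h4.congr' ?_
    filter_upwards [eventually_ge_atTop 1] with n hn
    obtain ⟨γ, hγ, ⟨⟨μ₀, v₀, hμ₀, h1₀, hn₀⟩, hdom₀⟩⟩ := twoClusterRate_eq_relaxationRate n hn
    have hγeq : γ = γ₂ n := tendsto_nhds_unique hγ (h2 n hn)
    obtain ⟨⟨μ₁, v₁, hμ₁, h1₁, hn₁⟩, hdom₁⟩ := hs n hn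
    have hle1 : s n ≤ Real.exp (-γ) := hn₁.symm.le.trans (hdom₀ μ₁ v₁ hμ₁ h1₁)
    have hle2 : Real.exp (-γ) ≤ s n := hn₀.symm.le.trans (hdom₁ μ₀ v₀ hμ₀ h1₀)
    have hsn : s n = Real.exp (-γ) := le_antisymm hle1 hle2
    show (n : ℝ) * γ₂ n = n * -Real.log (s n)
    rw [hsn, Real.log_exp, neg_neg, hγeq]

/-- **`StripClusterRates` ⟺ Kac gap asymptotics of the planar `⋆`-chain.** The crux of route
`CardyBoundaryCoulombGas` (rank 3) is equivalent to the pair of single-limit spectral statements about the explicit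
stochastic matrices `planarTransfer (Finset.Icc 0 n)`: `n·(-log ρ_marked(n)) → π/3 = π·h_{1,3}` and
`n·(-log SLEM_unmarked(n)) → 2π = π·h_{1,5}` — the `m → ∞` limits, the order of limits and all percolation event
bookkeeping are discharged by the landed stubs of line `two-cluster-rate-is-stationary-gap`. [cite: Cardy1998, eq. (bb)] -/
theorem stripClusterRates_iff_kacGapAsymptotics :
    Summit.CriticalPhenomena.CardyFormulaZ2.Theses.CardyBoundaryCoulombGas.StripClusterRates ↔
    ((∀ r : ℕ → ℝ,
      (∀ n : ℕ, 1 ≤ n →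
        ((∃ (μ : ℂ) (v : PlanarRowState (Finset.Icc (0 : ℤ) n) → ℂ),
          (v ≠ 0 ∧ (∀ p, (∀ x, ¬ p.1.JoinedToStar x) → v p = 0) ∧
            ∀ p, (∃ x, p.1.JoinedToStar x) →
              ∑ q, (planarTransfer (Finset.Icc (0 : ℤ) n) p q : ℂ) * v q = μ * v p) ∧
          ‖μ‖ = r n) ∧
        ∀ (μ : ℂ) (v : PlanarRowState (Finset.Icc (0 : ℤ) n) → ℂ),
          (v ≠ 0 ∧ (∀ p, (∀ x, ¬ p.1.JoinedToStar x) → v p = 0) ∧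
            ∀ p, (∃ x, p.1.JoinedToStar x) →
              ∑ q, (planarTransfer (Finset.Icc (0 : ℤ) n) p q : ℂ) * v q = μ * v p) →
          ‖μ‖ ≤ r n)) →
      Tendsto (fun n : ℕ ↦ (n : ℝ) * -Real.log (r n)) atTop (𝓝 (Real.pi / 3))) ∧
    (∀ s : ℕ → ℝ,
      (∀ n : ℕ, 1 ≤ n →
        ((∃ (μ : ℂ) (v : PlanarRowState (Finset.Icc (0 : ℤ) n) → ℂ),
          (v ≠ 0 ∧ (∀ p, (∃ x, p.1.JoinedToStar x) → v p = 0) ∧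
            ∀ p, (∀ x, ¬ p.1.JoinedToStar x) →
              ∑ q, (planarTransfer (Finset.Icc (0 : ℤ) n) p q : ℂ) * v q = μ * v p) ∧
          μ ≠ 1 ∧ ‖μ‖ = s n) ∧
        ∀ (μ : ℂ) (v : PlanarRowState (Finset.Icc (0 : ℤ) n) → ℂ),
          (v ≠ 0 ∧ (∀ p, (∃ x, p.1.JoinedToStar x) → v p = 0) ∧
            ∀ p, (∀ x, ¬ p.1.JoinedToStar x) →
              ∑ q, (planarTransfer (Finset.Icc (0 : ℤ) n) p q : ℂ) * v q = μ * v p) →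
          μ ≠ 1 → ‖μ‖ ≤ s n)) →
      Tendsto (fun n : ℕ ↦ (n : ℝ) * -Real.log (s n)) atTop (𝓝 (2 * Real.pi)))) :=
  ⟨kacGapAsymptotics_of_stripClusterRates, stripClusterRates_of_kacGapAsymptotics⟩

end Summit.CriticalPhenomena.CardyFormulaZ2.Cruxes.StripClusterRates.TwoClusterRateIsStationaryGap

end
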